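import Literature.AlgebraicGeometry.Resolution.QuadraticTransformsRegular
import Mathlib.RingTheory.RegularLocalRing.Polynomial
import Mathlib.RingTheory.AlgebraicIndependent.Transcendental
import Mathlib.RingTheory.KrullDimension.Polynomial
import Mathlib.RingTheory.KrullDimension.Field
import Mathlib.FieldTheory.IntermediateField.Adjoin.Basic
import HarnessLib

/-!
# The polynomial model of a purely transcendental `k(x, y)` inside a valuation ring
# (crux `IndSmooth.ValuativeSmoothing`, line `birth`, stub `stub_polynomialModel`)

Stub `stub_polynomialModel` of the skeleton `Lines/birth.lean` (lead reshape r5, family 4: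
"regular centre of dimension `≤ 2` on some affine model") for crux
stmt-ResolutionOfSingularities-16087. Let `K ⊇ k` be generated as a field by an algebraically
independent pair `(x, y)` (every element of `K` is a quotient of two elements of `k[x, y]`), and
let `O ⊇ k` be any valuation ring of `K`. Put `x' := x` if `x ∈ O` and `x' := x⁻¹` otherwise,
and likewise `y'`. Then `B := k[x', y'] ⊆ O` is a finitely generated `k`-subalgebra with
`Frac B = K`; the pair `(x', y')` is again algebraically independent (replacing a member of an
algebraically independent family by its inverse preserves independence: transcendence of `x`
and of `x⁻¹` over `k[y]` are equivalent), so `B ≅ k[X, Y]` is a regular ring of Krull dimension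
`2`; hence the local ring `B_{𝔪_O ∩ B}` of `B` at the centre of `O` (`locAtCentre`) is a regular
local ring (`isRegularLocalRing_locAtCentre_of_isRegularRing`) of dimension `≤ 2` (it is the
localisation of `B` at a prime, `locAtCentreEquiv`/`isLocalization_locAtCentre`, and the height
of a prime is at most the dimension).
-/

-- single-problem summit: the doubled namespace component is forced
set_option linter.dupNamespace false

namespace Summit.ResolutionOfSingularities.ResolutionOfSingularities.Theorems.ValuativeSmoothing

open IsLocalRing Literature.AlgebraicGeometry.Resolution

/-- Replacing one member of an algebraically independent family in a field by itself or by its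
inverse keeps the family algebraically independent: by
`AlgebraicIndependent.iff_transcendental_adjoin_image` independence splits into independence of
the other members and transcendence of the chosen member over the subalgebra they generate, and
an element of a field is transcendental iff its inverse is (`IsAlgebraic.inv_iff`). [folklore] -/
theorem algebraicIndependent_of_eq_or_eq_inv {ι k K : Type*} [CommRing k] [Field K]
    [Algebra k K] {v w : ι → K} (hv : AlgebraicIndependent k v) (i : ι)
    (hne : ∀ j, j ≠ i → w j = v j) (hi : w i = v i ∨ w i = (v i)⁻¹) :
    AlgebraicIndependent k w := by
  rw [AlgebraicIndependent.iff_transcendental_adjoin_image i] at hv ⊢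
  obtain ⟨h1, h2⟩ := hv
  have hfun : (fun j : {j // j ≠ i} => w j) = fun j : {j // j ≠ i} => v j :=
    funext fun j => hne j.1 j.2
  have himage : w '' {i}ᶜ = v '' {i}ᶜ := Set.image_congr fun j hj => hne j hj
  refine ⟨hfun ▸ h1, ?_⟩
  rw [himage]
  rcases hi with hi | hi <;> rw [hi]
  · exact h2
  · exact fun halg => h2 (IsAlgebraic.inv_iff.mp halg)

/-- **Stub `stub_polynomialModel` (line `birth`, crux `IndSmooth.ValuativeSmoothing`; r5-S5).**
The polynomial model of a purely transcendental `K = k(x, y)` inside any valuation ring `O ⊇ k`: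
with `x' ∈ {x, x⁻¹} ∩ O`, `y' ∈ {y, y⁻¹} ∩ O`, the subalgebra `B = k[x', y'] ⊆ O` is finitely
generated with `Frac B = K`, `(x', y')` is again algebraically independent (so `B ≅ k[X, Y]` is a
regular ring of dimension `2`), hence `B` is regular at the centre of `O` with local ring of
dimension `≤ 2` (`isRegularLocalRing_locAtCentre_of_isRegularRing`; the local ring at the centre
is the localisation at a prime, whose dimension is the height of that prime). [folklore] -/
theorem stub_polynomialModel (k K : Type) [Field k] [Field K] [Algebra k K] (x y : K)
    (hxy : AlgebraicIndependent k ![x, y])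
    (hgen : ∀ z : K, ∃ a ∈ Algebra.adjoin k {x, y}, ∃ b ∈ Algebra.adjoin k {x, y},
      b ≠ 0 ∧ z = a / b)
    (O : ValuationSubring K) (hO : ∀ c : k, algebraMap k K c ∈ O) :
    ∃ B : Subalgebra k K, B.FG ∧ B.toSubring ≤ O.toSubring ∧
      (∀ z : K, ∃ a ∈ B, ∃ b ∈ B, b ≠ 0 ∧ z = a / b) ∧
      IsRegularLocalRing (locAtCentre B.toSubring O) ∧
      ringKrullDim (locAtCentre B.toSubring O) ≤ 2 := by
  classical
  -- normalise the generators into `O`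
  obtain ⟨x', hx'O, hx'⟩ : ∃ x' ∈ O, x' = x ∨ x' = x⁻¹ := by
    rcases O.mem_or_inv_mem x with h | h
    exacts [⟨x, h, Or.inl rfl⟩, ⟨x⁻¹, h, Or.inr rfl⟩]
  obtain ⟨y', hy'O, hy'⟩ : ∃ y' ∈ O, y' = y ∨ y' = y⁻¹ := by
    rcases O.mem_or_inv_mem y with h | h
    exacts [⟨y, h, Or.inl rfl⟩, ⟨y⁻¹, h, Or.inr rfl⟩]
  -- `(x', y')` is algebraically independent
  have hind₁ : AlgebraicIndependent k ![x', y] :=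
    algebraicIndependent_of_eq_or_eq_inv hxy 0
      (Fin.forall_fin_two.mpr ⟨fun h => absurd rfl h, fun _ => by simp⟩) (by simpa using hx')
  have hind : AlgebraicIndependent k ![x', y'] :=
    algebraicIndependent_of_eq_or_eq_inv hind₁ 1
      (Fin.forall_fin_two.mpr ⟨fun _ => by simp, fun h => absurd rfl h⟩) (by simpa using hy')
  -- the model
  set B : Subalgebra k K := Algebra.adjoin k {x', y'}
  have hrange : Set.range ![x', y'] = {x', y'} := Matrix.range_cons_cons_empty x' y' _
  -- `B ≅ k[X, Y]`
  let e : MvPolynomial (Fin 2) k ≃ₐ[k] B :=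
    hind.aevalEquiv.trans (Subalgebra.equivOfEq _ _ (by rw [hrange]))
  -- `B ⊆ O`
  let O' : Subalgebra k K := { O.toSubring with algebraMap_mem' := hO }
  have hBO' : B ≤ O' := Algebra.adjoin_le (by
    intro w hw
    rcases hw with rfl | rfl
    exacts [hx'O, hy'O])
  have hBO : B.toSubring ≤ O.toSubring := fun w hw => hBO' hw
  -- `Frac B = K`
  set E : IntermediateField k K := IntermediateField.adjoin k {x', y'}
  have hx'E : x' ∈ E := IntermediateField.subset_adjoin k _ (Set.mem_insert _ _)
  have hy'E : y' ∈ E := IntermediateField.subset_adjoin k _ (Set.mem_insert_of_mem _ rfl)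
  have hxE : x ∈ E := by
    rcases hx' with h | h
    · exact h ▸ hx'E
    · rw [← inv_inv x, ← h]; exact inv_mem hx'E
  have hyE : y ∈ E := by
    rcases hy' with h | h
    · exact h ▸ hy'E
    · rw [← inv_inv y, ← h]; exact inv_mem hy'E
  have hadj : Algebra.adjoin k {x, y} ≤ E.toSubalgebra := Algebra.adjoin_le (by
    intro w hw
    rcases hw with rfl | rfl
    exacts [hxE, hyE])
  have hE : ∀ z : K, z ∈ E := fun z => by
    obtain ⟨a, ha, b, hb, -, rfl⟩ := hgen z
    have haE : a ∈ E := hadj ha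
    have hbE : b ∈ E := hadj hb
    exact div_mem haE hbE
  have hfrac : ∀ z : K, ∃ a ∈ B, ∃ b ∈ B, b ≠ 0 ∧ z = a / b := fun z => by
    obtain ⟨a, ha, b, hb, hab⟩ : ∃ a ∈ B, ∃ b ∈ B, z = a / b :=
      IntermediateField.mem_adjoin_iff_div.mp (hE z)
    by_cases hb0 : b = 0
    · exact ⟨0, B.zero_mem, 1, B.one_mem, one_ne_zero, by rw [hab, hb0, div_zero, zero_div]⟩
    · exact ⟨a, ha, b, hb, hb0, hab⟩
  -- regularity at the centre
  have hregB : IsRegularRing B.toSubring := IsRegularRing.of_ringEquiv e.toRingEquiv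
  have hreg : IsRegularLocalRing (locAtCentre B.toSubring O) :=
    isRegularLocalRing_locAtCentre_of_isRegularRing hBO
  -- dimension at the centre
  have hdimB : ringKrullDim B = 2 := by
    rw [← ringKrullDim_eq_of_ringEquiv e.toRingEquiv,
      MvPolynomial.ringKrullDim_of_isNoetherianRing, ringKrullDim_eq_zero_of_field]
    simp
  have hdim : ringKrullDim (locAtCentre B.toSubring O) ≤ 2 := by
    haveI := isLocalization_locAtCentre hBO
    rw [IsLocalization.AtPrime.ringKrullDim_eq_height (subringCentre B.toSubring O hBO)
      (locAtCentre B.toSubring O)]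
    exact (Ideal.height_le_ringKrullDim_of_isPrime).trans hdimB.le
  exact ⟨B, Subalgebra.fg_def.mpr ⟨{x', y'}, (Set.finite_singleton y').insert x', rfl⟩, hBO,
    hfrac, hreg, hdim⟩

end Summit.ResolutionOfSingularities.ResolutionOfSingularities.Theorems.ValuativeSmoothing
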